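import Summits.AtomisticToContinuum.BoseEinsteinCondensation.Theses.BECDipoleTransport

/-!
# AtomisticToContinuum / BoseEinsteinCondensation — route `BECDipoleTransport`, assembly

Settles the assembly item `stmt-AtomisticToContinuum-14627` of route
`route-AtomisticToContinuum-BECDipoleTransport`: the implication
`HoleLinearResponse → LongitudinalForceBound → DipoleTransportCost → MesoscopicTail →
BoundaryTransferWeak → TransportToWindow → WindowModeCounting → BoseEinsteinCondensation`.

The hypotheses of `Assembly` are, verbatim and in the same order, those of the route's deciding
theorem `closes`, so the assembly is that theorem curried; the composition is spelled out again
below for the record. Fix a repulsive finite-range `v`: `LongitudinalForceBound` gives the engine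
body for `v`, `DipoleTransportCost` turns it into Leg 1 (the transport-cost bound),
`HoleLinearResponse` is Leg 2, `TransportToWindow` composes the two legs into the Gaussian-window
occupation bound, `WindowModeCounting` adds `MesoscopicTail` (Parseval count) to reach the
periodic-BEC body for `v` (constant-mode occupation `≥ N/2`), and `BoundaryTransferWeak` yields
`∃ ρ₀ > 0, ∀ ρ ∈ (0, ρ₀), HasGroundStateBEC v ρ`, i.e. the sub-problem statement
`BoseEinsteinCondensation`. Pure logic; no analytic content lives here.
-/

namespace Summit.AtomisticToContinuum.BoseEinsteinCondensation.Theorems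

/-- Settles `stmt-AtomisticToContinuum-14627` (exact signature): the assembly of route
`BECDipoleTransport`, i.e. its seven items imply the sub-problem statement
`BoseEinsteinCondensation`. Proof: for each repulsive finite-range `v`, `BoundaryTransferWeak`
applied to the periodic-BEC body produced by `WindowModeCounting` from the Gaussian window
(`TransportToWindow` fed with Leg 1 = `DipoleTransportCost ∘ LongitudinalForceBound` and
Leg 2 = `HoleLinearResponse`) and the tail bound `MesoscopicTail`. [folklore] -/
theorem becDipoleTransport_assembly_proof :
    Summit.AtomisticToContinuum.BoseEinsteinCondensation.Theses.BECDipoleTransport.Assembly := by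
  unfold Theses.BECDipoleTransport.Assembly
  intro h₁ h₂ h₃ h₄ h₅ h₆ h₇ v hv
  exact h₅ v hv (h₇ v hv (h₆ v hv (h₃ v hv (h₂ v hv)) (h₁ v hv)) (h₄ v hv))

end Summit.AtomisticToContinuum.BoseEinsteinCondensation.Theorems
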